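import Summits.CriticalPhenomena.PercolationContinuityZ3.Theorems.Transplant.SkelPhiFatSeqOff
import HarnessLib

/-!
# D″ node v2.1 (DPRIME-SCOPE addendum N, "typed route centres"): TYPED CENTRES and SEED NESTING for a bare planar map —
# every vertex `c` has, in the orbit of ONE base vertex `t₀`, a partner `c′ = α_c t₀` (the image of `t₀` under `c`'s frame) at a planar offset in
# the FINITE set `{φ t₀ − φ t : t ∈ types}` and at bounded induced distance inside `c`'s cylinders; and the shifted fat prism (Step-I′ seed) of a
# smaller scale at `c′` lies in the one of a larger scale at `c` — so a link input AT THE TYPED CENTRE implies the link from the kit's seed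
# (`linkIn_mono`), which is how v2.1 feeds the chains from a single monotone band

builds on p205010 (kernel theorem, internal audit signed; external expert review pending) — nothing in this file uses p205010.
Lane `prim-bschramm`, seat `prim-bschramm-p3` (gen 7; D″ design owner); helper file (`--supports stmt-CriticalPhenomena-4575`).
* §1 `exists_mem_box` (every planar vector lies in some `Λ_k`), **`exists_typeReach (hκ) (ht₀)`**: `∃ k₀ dI, 1 ≤ k₀ ∧ ∀ t ∈ types,
  φ t₀ − φ t ∈ Λ_{k₀} ∧ t₀ ∈ cylBall t k₀ dI` (finitely many types, (κ));
* §2 **`exists_typedCtr (hfr) t₀ c`**: `∃ c′ α t, t ∈ types ∧ α t = c ∧ α t₀ = c′ ∧ (φ ∘ α = φ + (φ c − φ t)) ∧ φ c′ − φ c = φ t₀ − φ t`, with the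
  transports `typedCtr_frame` (`φ ∘ α = φ + (φ c′ − φ t₀)`: `α` is ALSO a frame of `c′` over `t₀`) and `typedCtr_mem_cylBall`
  (`t₀ ∈ cylBall t k dI → c′ ∈ cylBall c k dI`);
* §3 `le_fatRadius_add` (`ψ n + d ≤ ψ (n + d)`), **`fatSeqOff_subset_fatSeqOff_of_near`** (`c′ ∈ cylBall c k dI`, `φ c′ − φ c ∈ Λ_d`, `k′ + d ≤ k`,
  `dI + ψ k′ + off′ ≤ ψ k + off` ⟹ `fatSeqOff off′ c′ k′ ⊆ fatSeqOff off c k`) and the packaged form `fatSeqOff_typed_subset`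
  (`k′ + max d dI ≤ k`, `off′ ≤ off`).
[cite: KozmaNitzan2024, §4 p. 15 (the lattice symmetries), p. 17 (Step I)]
-/

noncomputable section

open MeasureTheory

namespace Summit.CriticalPhenomena.PercolationContinuityZ3.Theorems.Transplant

namespace Skelφ

open Literature.Probability.Percolation Literature.Probability.LatticeModels SimpleGraph
open Literature.Barriers.CriticalPhenomena (graphBall graphBall_finite mem_graphBall_self graphBall_mono)
open scoped Classical

variable {V : Type} {G : SimpleGraph V} [G.LocallyFinite] {φ : V → Site 2} {types : Finset V}

/-! ## §1 Every base vertex is reached from every other inside a fixed cylinder -/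

omit [G.LocallyFinite] in
/-- Every planar vector lies in some box `Λ_k`. [folklore] -/
theorem exists_mem_box (x : Site 2) : ∃ k : ℕ, x ∈ box 2 k := by
  refine ⟨Finset.univ.sup fun i => (x i).natAbs, ?_⟩
  rw [mem_box]
  intro i
  have hk : |x i| ≤ ((Finset.univ.sup fun i => (x i).natAbs : ℕ) : ℤ) := by
    rw [← Int.natCast_natAbs]
    exact_mod_cast Finset.le_sup (f := fun i => (x i).natAbs) (Finset.mem_univ i)
  exact abs_le.1 hk

omit [G.LocallyFinite] in
/-- **Type reach**: for a base vertex `t₀` there are `k₀ ≥ 1` and `dI` with, for EVERY base vertex `t`, `φ t₀ − φ t ∈ Λ_{k₀}` and `t₀` within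
INDUCED distance `dI` of `t` inside the cylinder `cyl t k₀` (finitely many types; (κ) makes each such cylinder connected). [folklore] -/
theorem exists_typeReach (hκ : CylConn G φ types) (t₀ : V) :
    ∃ k₀ dI : ℕ, 1 ≤ k₀ ∧ ∀ t ∈ types, φ t₀ - φ t ∈ box 2 k₀ ∧ t₀ ∈ cylBall G φ t k₀ dI := by
  -- a common planar box
  have hbox : ∀ t ∈ types, ∃ k : ℕ, φ t₀ - φ t ∈ box 2 k := fun t _ => exists_mem_box _
  choose! kt hkt using hbox
  set k₀ : ℕ := types.sup kt + 1 with hk₀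
  have hk₀t : ∀ t ∈ types, φ t₀ - φ t ∈ box 2 k₀ := fun t ht =>
    box_mono 2 (by have := Finset.le_sup (f := kt) ht; omega) (hkt t ht)
  -- an induced walk in each cylinder `cyl t k₀` (connected by (κ), `k₀ ≥ 1`)
  have hwalk : ∀ t ∈ types, ∃ d : ℕ, t₀ ∈ cylBall G φ t k₀ d := by
    intro t ht
    have hmem : t₀ ∈ cyl φ t k₀ := by rw [mem_cyl]; exact hk₀t t ht
    obtain ⟨w⟩ := (hκ.connected ht (show 1 ≤ k₀ by omega)).preconnected ⟨t, self_mem_cyl φ t k₀⟩ ⟨t₀, hmem⟩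
    exact ⟨w.length, ⟨⟨t₀, hmem⟩, ⟨w, le_rfl⟩, rfl⟩⟩
  choose! dt hdt using hwalk
  refine ⟨k₀, types.sup dt, by omega, fun t ht => ⟨hk₀t t ht, ?_⟩⟩
  exact cylBall_mono G φ t le_rfl (Finset.le_sup (f := dt) ht) (hdt t ht)

/-! ## §2 Typed centres -/

omit [G.LocallyFinite] in
/-- **The typed centre of `c` over `t₀`**: the image `c′ := α t₀` of `t₀` under `c`'s frame `α` (`α t = c`, `φ ∘ α = φ + (φ c − φ t)`); its planar
offset from `c` is `φ t₀ − φ t`, one of finitely many vectors. [cite: KozmaNitzan2024, §4 p. 15 (the lattice symmetries)] -/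
theorem exists_typedCtr (hfr : Frames G φ types) (t₀ c : V) :
    ∃ (c' : V) (α : G ≃g G) (t : V), t ∈ types ∧ α t = c ∧ α t₀ = c' ∧ (∀ w, φ (α w) = φ w + (φ c - φ t)) ∧ φ c' - φ c = φ t₀ - φ t := by
  obtain ⟨t, ht, α, hαt, hα⟩ := hfr c
  refine ⟨α t₀, α, t, ht, hαt, rfl, hα, ?_⟩
  rw [hα t₀]; abel

omit [G.LocallyFinite] in
/-- The frame of `c` over `t` is also a frame of the typed centre `c′ = α t₀` over `t₀`: `φ ∘ α = φ + (φ c′ − φ t₀)`. [folklore] -/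
theorem typedCtr_frame {α : G ≃g G} {t c t₀ : V} (hα : ∀ w, φ (α w) = φ w + (φ c - φ t)) :
    ∀ w, φ (α w) = φ w + (φ (α t₀) - φ t₀) := by
  intro w
  rw [hα w, hα t₀]; abel

omit [G.LocallyFinite] in
/-- **The typed centre is induced-close to `c`**: if `t₀ ∈ cylBall t k dI` then `c′ = α t₀ ∈ cylBall c k dI` (frames carry fat prisms to fat
prisms). [folklore] -/
theorem typedCtr_mem_cylBall {α : G ≃g G} {t c t₀ : V} (hαt : α t = c) (hα : ∀ w, φ (α w) = φ w + (φ c - φ t)) {k dI : ℕ}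
    (hI : t₀ ∈ cylBall G φ t k dI) : α t₀ ∈ cylBall G φ c k dI := by
  rw [← image_cylBall_of_frame hαt hα k dI]
  exact Set.mem_image_of_mem α hI

/-! ## §3 Seed nesting across nearby centres -/

/-- `ψ n + d ≤ ψ (n + d)` (the fat radius grows at least like the scale). [folklore] -/
theorem le_fatRadius_add [Countable V] (hfr : Frames G φ types) {p : unitInterval} (hC : CylSubcritical G φ types p) (n d : ℕ) :
    fatRadius hfr hC n + d ≤ fatRadius hfr hC (n + d) := by
  induction d with
  | zero => simp
  | succ d ih =>
    have h := fatRadius_succ_ge hfr hC (n + d)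
    show fatRadius hfr hC n + (d + 1) ≤ fatRadius hfr hC (n + d + 1)
    omega

/-- **SEED NESTING**: a typed centre `c′` induced-close to `c` (`c′ ∈ cylBall c k dI`) at planar offset in `Λ_d`, a smaller scale `k′ + d ≤ k` and
radii with `dI + ψ k′ + off′ ≤ ψ k + off` give `fatSeqOff off′ c′ k′ ⊆ fatSeqOff off c k` — so `linkIn R (fatSeqOff off′ c′ k′) H ⊆
linkIn R (fatSeqOff off c k) H` (`linkIn_mono`): the route input at the typed centre implies the kit's `h3`. [cite: KozmaNitzan2024, §4 p. 17 (Step I)] -/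
theorem fatSeqOff_subset_fatSeqOff_of_near [Countable V] (hfr : Frames G φ types) {p : unitInterval} (hC : CylSubcritical G φ types p)
    {c c' : V} {k k' d dI off off' : ℕ} (hc' : c' ∈ cylBall G φ c k dI) (hbox : φ c' - φ c ∈ box 2 d) (hk : k' + d ≤ k)
    (hψ : dI + fatRadius hfr hC k' + off' ≤ fatRadius hfr hC k + off) :
    fatSeqOff hfr hC off' c' k' ⊆ fatSeqOff hfr hC off c k := by
  intro z hz
  rw [mem_fatSeqOff_iff] at hz ⊢
  have hcyl : cyl φ c' k' ⊆ cyl φ c k := cyl_subset_cyl_of_sub_mem_box hbox hk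
  have h := cylBall_subset_cylBall_of_mem hc' hcyl hz
  exact cylBall_mono G φ c le_rfl (by omega) h

/-- **Seed nesting, packaged for the v2.1 calls**: with the type reach `(k₀, dI)` of `t₀`, a typed centre `c′ = α t₀` of `c`, scales
`k′ + max k₀ dI ≤ k` and offsets `off′ ≤ off`: `fatSeqOff off′ c′ k′ ⊆ fatSeqOff off c k`. [cite: KozmaNitzan2024, §4 p. 17 (Step I)] -/
theorem fatSeqOff_typed_subset [Countable V] (hfr : Frames G φ types) {p : unitInterval} (hC : CylSubcritical G φ types p)
    {α : G ≃g G} {t c t₀ : V} (ht : t ∈ types) (hαt : α t = c) (hα : ∀ w, φ (α w) = φ w + (φ c - φ t))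
    {k₀ dI : ℕ} (hreach : φ t₀ - φ t ∈ box 2 k₀ ∧ t₀ ∈ cylBall G φ t k₀ dI)
    {k k' off off' : ℕ} (hk : k' + max k₀ dI ≤ k) (hoff : off' ≤ off) :
    fatSeqOff hfr hC off' (α t₀) k' ⊆ fatSeqOff hfr hC off c k := by
  have _ := ht
  have hk₀k : k₀ ≤ k := le_trans (le_max_left _ _) (le_trans (Nat.le_add_left _ _) hk)
  -- the typed centre is induced-close to `c` inside `cyl c k`
  have hc' : α t₀ ∈ cylBall G φ c k dI :=
    cylBall_mono G φ c hk₀k le_rfl (typedCtr_mem_cylBall hαt hα hreach.2)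
  -- its planar offset
  have hbox : φ (α t₀) - φ c ∈ box 2 k₀ := by
    rw [hα t₀, show φ t₀ + (φ c - φ t) - φ c = φ t₀ - φ t by abel]
    exact hreach.1
  refine fatSeqOff_subset_fatSeqOff_of_near hfr hC hc' hbox (le_trans (by omega) hk) ?_
  have h1 := le_fatRadius_add hfr hC k' (max k₀ dI)
  have h2 := fatRadius_mono hfr hC hk
  have h3 : dI ≤ max k₀ dI := le_max_right _ _
  omega

end Skelφ

end Summit.CriticalPhenomena.PercolationContinuityZ3.Theorems.Transplant

end
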